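import Mathlib

/-!
# Sketch (hub-lb-chord-idea-1 g1) — «distance is a cover»

In a translation-invariant word program the FAR star-join of a rider family (host block `E`
plus one rider clique `N ∪ τF₀`, `N ⊆ E` the separator next to the far family) is, entry by
entry, the POSITION COVER `{E}, {τ⁻¹N ∪ F₀}` of the NEAR joint program over `E ∪ F₀ (∪ τ⁻¹N)`:
translating the whole rider clique back by `τ⁻¹` changes no Gram entry (moments are functions
of translation classes), and the back-translated clique is a principal sub-block of the near
dense block.  Hence `v(far dense) = v(far star) ≤ v(near dense)` (the first equality is the
base seat's private-corner exactness, `Literature.Analysis.Matrix.ChordalCompletion`), and when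
`F₀ ⊆ E` and `τ⁻¹N ⊆ E` the far rider is implied by the host block alone (exactly inert).

Abstract setting: `W` = placed words, `ω : W → W → R` the Gram functional `ω a b = L(a† b)` at a
fixed moment point, `τinv : W → W` a lattice translation leaving every TI moment point
invariant: `ω (τinv a) (τinv b) = ω a b`.  Nothing here is specific to fermions or to Hubbard;
no summit statement is touched; 0 sorries intended.
-/

namespace Summit.Ventures.CertifiedManyBodySolver.Cruxes.LowerEdge_ge_m4o5.ChordIdea1g1

open Matrix

variable {W R κ n : Type*}

/-- Gram block of the clique indexed by `c : κ → W`. -/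
def gram (ω : W → W → R) (c : κ → W) : Matrix κ κ R := Matrix.of fun i j => ω (c i) (c j)

@[simp] theorem gram_apply (ω : W → W → R) (c : κ → W) (i j : κ) :
    gram ω c i j = ω (c i) (c j) := rfl

/-- Translate cliques have identical Gram blocks (= the base seat's `translate_clique_gram_eq`). -/
theorem gram_translate (ω : W → W → R) (τ : W → W)
    (hτ : ∀ a b, ω (τ a) (τ b) = ω a b) (c : κ → W) :
    gram ω (τ ∘ c) = gram ω c := by
  ext i j; simp [hτ]

/-- Re-indexing a clique inside a bigger word list gives a principal submatrix. -/
theorem gram_comp_eq_submatrix (ω : W → W → R) (e : n → W) (j : κ → n) :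
    gram ω (e ∘ j) = (gram ω e).submatrix j j := by
  ext i k; simp

/-- **Distance is a cover (identity of blocks).** If every word of the far rider clique `c`
back-translates (via `τinv`) to a word of the near list `e` (re-indexing `j`), the far clique's
Gram block IS the principal submatrix of the near block on `j` — same variables, same entries. -/
theorem farClique_gram_eq_near_submatrix (ω : W → W → R) (τinv : W → W)
    (hτ : ∀ a b, ω (τinv a) (τinv b) = ω a b)
    (c : κ → W) (e : n → W) (j : κ → n) (hj : ∀ i, e (j i) = τinv (c i)) :
    gram ω c = (gram ω e).submatrix j j := by
  have h1 : gram ω (τinv ∘ c) = gram ω c := gram_translate ω τinv hτ c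
  have h2 : (e ∘ j) = τinv ∘ c := funext hj
  rw [← h1, ← h2, gram_comp_eq_submatrix]

section cone
variable [Ring R] [PartialOrder R] [StarRing R]

/-- **Distance is a cover (cone side).** PSD of the near dense block implies PSD of the far
rider clique's block, so the far star-join's cone constraints are implied by the near joint's
(the host block is common to both programs; rider rows are translates of near rows). -/
theorem farClique_posSemidef_of_near (ω : W → W → R) (τinv : W → W)
    (hτ : ∀ a b, ω (τinv a) (τinv b) = ω a b)
    (c : κ → W) (e : n → W) (j : κ → n) (hj : ∀ i, e (j i) = τinv (c i))
    (hnear : (gram ω e).PosSemidef) : (gram ω c).PosSemidef := by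
  rw [farClique_gram_eq_near_submatrix ω τinv hτ c e j hj]
  exact hnear.submatrix j

/-- **Exactly inert case.** If the far clique back-translates into the HOST word list itself
(`F₀ ⊆ E` and `τ⁻¹N ⊆ E`), its PSD constraint is implied by the host block alone: joining
translated copies of host sub-families through a separator adds no constraint at all. -/
theorem farClique_posSemidef_of_host (ω : W → W → R) (τinv : W → W)
    (hτ : ∀ a b, ω (τinv a) (τinv b) = ω a b)
    (c : κ → W) (hostIdx : n → W) (j : κ → n) (hj : ∀ i, hostIdx (j i) = τinv (c i))
    (hhost : (gram ω hostIdx).PosSemidef) : (gram ω c).PosSemidef :=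
  farClique_posSemidef_of_near ω τinv hτ c hostIdx j hj hhost

end cone

/-- **Value side.** Over a type `Y` of moment points: near joint = `host ∧ nearPSD ∧ rows`,
far star-join = `host ∧ farPSD ∧ rows` (rider rows are translates of near rows: same predicate).
If `nearPSD → farPSD` pointwise (the cone lemma at every point) then the far star-join is a
relaxation of the near joint: `v(far star) ≤ v(near joint)`. -/
theorem farStar_value_le_nearJoint {Y : Type*} (obj : Y → ℝ)
    (host rows nearPSD farPSD : Y → Prop)
    (himp : ∀ y, nearPSD y → farPSD y)
    (hbdd : BddBelow (obj '' {y | host y ∧ farPSD y ∧ rows y}))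
    (hne : (obj '' {y | host y ∧ nearPSD y ∧ rows y}).Nonempty) :
    sInf (obj '' {y | host y ∧ farPSD y ∧ rows y})
      ≤ sInf (obj '' {y | host y ∧ nearPSD y ∧ rows y}) := by
  refine csInf_le_csInf hbdd hne (Set.image_mono ?_)
  intro y hy
  exact ⟨hy.1, himp y hy.2.1, hy.2.2⟩

/-- **Exactly inert, value form.** If the far clique's PSD is implied by the host block
(`farClique_posSemidef_of_host` pointwise), the far star-join has the SAME value as the host
program alone. -/
theorem farStar_value_eq_host {Y : Type*} (obj : Y → ℝ)
    (host rows farPSD : Y → Prop) (himp : ∀ y, host y → farPSD y) :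
    sInf (obj '' {y | host y ∧ farPSD y ∧ rows y}) = sInf (obj '' {y | host y ∧ rows y}) := by
  congr 1
  ext v
  constructor
  · rintro ⟨y, hy, rfl⟩; exact ⟨y, ⟨hy.1, hy.2.2⟩, rfl⟩
  · rintro ⟨y, hy, rfl⟩; exact ⟨y, ⟨hy.1, himp y hy.1, hy.2⟩, rfl⟩

end Summit.Ventures.CertifiedManyBodySolver.Cruxes.LowerEdge_ge_m4o5.ChordIdea1g1
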